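import Summits.HodgeConjecture.CorCM.Census.DihedralFourCoreSpecies

/-!
# The D₄ four-core — the WEIL COLUMN: no imaginary quadratic subfield; the F-9 species ARE generalised Weil classes of the non-Galois quartic
# CM fields `K₁`, `K₂` on CM eightfolds (kernel census)

COR-CM (cell `pub-hodgecm2`), count-neutral kernel census by the PORTFOLIO seat lit-andre-3 (gen 11); the `D₄` row of the octic WEIL COLUMN
(`Census/OcticTriquadraticWeilColumn.lean` — QUESTION and dictionaries (W), (W′) in its module docstring —, `Census/OcticC4C2NonsquareWeilColumn.lean`,
`Census/OcticRealQuadraticRowsWeilColumn.lean`), on gen 7's model of the `D₄` slice (`Census/DihedralSurfaceTripleDegrees.lean` §3 and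
`Census/DihedralFourCoreSpecies.lean`: sixteen labels `(b, i)`, surfaces `0 = S₁`, `1 = S₂`, `2 = S₁′`, `3 = S₂′` with CM by the non-Galois quartic
CM fields `K₁`, `K₂ =` reflex of `K₁`, and their conjugates `K₁′`, `K₂′` inside the Galois closure `F` (group `D₄ = ⟨r, s⟩`, `c = r²`), action
`act4 j f = rʲsᶠ`, type `phi4`, species `t1Set` (F-9 of `Y₁ = S₁ × S₂ × S₁′`), `t1pSet`, `t2Set` (F-9 of the mirror `Y₂ = S₁ × S₂ × S₂′`), `t2pSet`;
LATTICE THEOREM `DihedralFourCoreLattice.isHodgeVec_iff`: the Hodge lattice of ALL `S₁^a × S₂^b × S₁′^c × S₂′^d` is `ℤ⟨8 pairs, T1(0), T1(1), T2(0), T2(1)⟩`).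
Cell note `HOME/pub-hodgecm2-lit-andre-3/PORTFOLIO-lit-andre-3-g11.md`.  No named fact, no geometry, no `sorry`: `decide` only.

DICTIONARY (W′) (recalled; [cite: MoonenZarhin1998WeilClasses, §2]): for a CM subfield `K = F^H` the TYPE lattice of the generalised Weil classes
`⋀^r_K H¹(X)` on members `X` of the slice is the lattice of `H`-invariant Pohlmann–Hodge exponent vectors; the carrier multiplicities are the traces over
a transversal of `G/H`; a CM field `K′ ⊂ End⁰(X)` no conjugate of which lies in `F` … precisely: whose image meets `F` in a totally real field has all its
Weil types in the pair lattice `P`.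

KERNEL.
* `conj_eq_rot_sq`: `c = r·r` — every character `D₄ → ℤ/2` kills `c`, every quadratic subfield of `F` is REAL: NO Weil class of an imaginary quadratic
  field on any member of the slice is exceptional ((W1)); the theorems of Schoen / van Geemen / Markman do not touch the `D₄` slice.
* `reflections_census`: the four reflections `rʲs` are involutions different from `c` (the order-`2` subgroups avoiding `c`; their fixed fields are the
  quartic CM subfields, `j` even ↔ the conjugates of `K₁` — they fix labels of the `K₁`-surfaces `S₁, S₁′` only —, `j` odd ↔ the conjugates of `K₂`),
  and the rotations act simply transitively on the labels of each surface (so the trace of a vector over the transversal `{rʲ}` is its block degree).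
* `species_reflection_invariant`: EVERY species set is invariant under exactly the right reflection — `T1(i)`, `T1′(i)` under `r^{2i}s` (a `K₁`-type
  reflection), `T2(i)`, `T2′(i)` under `r^{2i+1}s` (a `K₂`-type reflection).  With the block degrees `(1,2,1,0)`, `(1,0,1,2)`, `(2,1,0,1)`, `(0,1,2,1)`
  (`species_mdeg_and_conj` of the species file) and (W′): `T1(i)` is the type of the generalised Weil class `⋀⁴_K H¹(S₁ × S₂² × S₁′)` for `K` the
  conjugate of `K₁` fixed by `r^{2i}s` (`K`-rank `4` on a CM EIGHTFOLD; `K` acts on `S₁`, `S₁′` through `K ≅ K₁, K₁′ = End⁰` and on `S₂²` through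
  `K ⊂ M₂(K₂)`), `T2(i)` that of `⋀⁴_{K} H¹(S₁² × S₂ × S₂′)` for `K` a conjugate of `K₂`; likewise `T1′`, `T2′`.
CONSEQUENCE (with `DihedralFourCoreLattice.isHodgeVec_iff`, informal through (O1)–(O4)): `P + W_{K₁} + W_{K₁′} + W_{K₂} + W_{K₂′} = H` (index `1`; exact
oracle `scratch/genweil.py`: each `W_K` alone has full rank `12` and index `2`) — the cell's two F-9 problems («one algebraic class in `E(Y₁)`, one in
`E(Y₂)`», gens 2–7) ARE Moonen–Zarhin's question for the generalised Weil classes of the non-Galois QUARTIC CM fields `K₁`, `K₂` on the CM eightfolds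
`S₁ × S₂² × S₁′` and `S₁² × S₂ × S₂′`; nothing in the `D₄` slice is reachable by Weil classes of imaginary quadratic fields.  HC_CM is NOT proved here.

## References
* [Pohlmann1968] H. Pohlmann, Ann. of Math. 88 (1968), Thm 1.  [MoonenZarhin1998WeilClasses] B. Moonen, Yu. Zarhin, J. reine angew. Math. 496 (1998) =
  alg-geom/9612017, §2.  [MoonenZarhin1999LowDim] B. Moonen, Yu. Zarhin, Math. Ann. 315 (1999), §4 (simple CM abelian surfaces, `D₄`).

## Provenance
Exact oracles in the seat folder `scratch/` (copies `HOME/pub-hodgecm2-lit-andre-3/g11/`): `genweil.py`, `genweil2.py` (row `D4`), inline check of the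
reflection invariances; this file is hand-written.
-/

namespace Summit.HodgeConjecture.CorCM.Census.DihedralSurfaceTriple.FourCore

open Finset

/-- **`c = r²` is a square**: `act4 2 false = act4 1 false ∘ act4 1 false`; hence every homomorphism `D₄ → ℤ/2` kills `c`, every index-`2` subgroup
contains `c`, and every quadratic subfield of `F` is real. [folklore] -/
theorem conj_eq_rot_sq : ∀ x : Pt4, act4 2 false x = act4 1 false (act4 1 false x) := by
  decide

/-- **Reflections census.** (i) each `rʲs` is an involution and is not `c` (the four order-`2` subgroups avoiding `c` ↔ the four quartic CM subfields);
(ii) `rʲs` fixes labels only on the `K₁`-surfaces `S₁, S₁′` (blocks `0, 2`) for `j` even and only on the `K₂`-surfaces `S₂, S₂′` (blocks `1, 3`) for `j`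
odd — its fixed field is a conjugate of `K₁` resp. `K₂`; (iii) the rotations act simply transitively on the four labels of each surface (so traces over
the transversal `{rʲ}` are block degrees). [folklore] -/
theorem reflections_census :
    (∀ j : ZMod 4, (∀ x : Pt4, act4 j true (act4 j true x) = x) ∧ ∃ x : Pt4, act4 j true x ≠ act4 2 false x) ∧
    (∀ j : ZMod 4, ∀ b : Fin 4, ∀ i : ZMod 4, act4 j true (b, i) = (b, i) → (b = 0 ∨ b = 2 ↔ j = 0 ∨ j = 2)) ∧
    (∀ j : ZMod 4, ∃ b : Fin 4, ∃ i : ZMod 4, act4 j true (b, i) = (b, i)) ∧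
    (∀ b : Fin 4, ∀ i i' : ZMod 4, (univ.filter fun j : ZMod 4 => act4 j false (b, i) = (b, i')).card = 1) := by
  refine ⟨by decide, by decide, by decide, by decide⟩

/-- **Every species set is invariant under the right reflection**: `T1(i)` and `T1′(i)` under `r^{2i}s`, `T2(i)` under `r^{2i+1}s`, `T2′(i)` under
`r^{2i+3}s`; and under no reflection of the other parity.  By (W′) and the block degrees (`species_mdeg_and_conj`): `T1(i)` = type of
`⋀⁴_K H¹(S₁ × S₂² × S₁′)` (`K` a conjugate of `K₁`), `T1′(i)` = type of `⋀⁴_K H¹(S₁ × S₁′ × S₂′²)`, `T2(i)` = type of `⋀⁴_K H¹(S₁² × S₂ × S₂′)`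
(`K` a conjugate of `K₂`), `T2′(i)` = type of `⋀⁴_K H¹(S₂ × S₁′² × S₂′)` — generalised Weil classes of quartic CM fields on CM eightfolds.
[cite: MoonenZarhin1998WeilClasses, §2] -/
theorem species_reflection_invariant : ∀ i : ZMod 4,
    ((t1Set i).image (act4 (2 * i) true) = t1Set i ∧ (t1pSet i).image (act4 (2 * i) true) = t1pSet i ∧
      (t2Set i).image (act4 (2 * i + 1) true) = t2Set i ∧ (t2pSet i).image (act4 (2 * i + 3) true) = t2pSet i) ∧
    ((t1Set i).image (act4 (2 * i + 1) true) ≠ t1Set i ∧ (t1Set i).image (act4 (2 * i + 3) true) ≠ t1Set i ∧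
      (t2Set i).image (act4 (2 * i) true) ≠ t2Set i ∧ (t2Set i).image (act4 (2 * i + 2) true) ≠ t2Set i) := by
  decide

end Summit.HodgeConjecture.CorCM.Census.DihedralSurfaceTriple.FourCore
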